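import Summits.ResolutionOfSingularities.ResolutionOfSingularities.Theorems.FrobeniusClosingPatchingRelPerfectDepthHSepComponentsExp
import Literature.AlgebraicGeometry.Resolution.AlterationsMultisectionLocalStepProofs
import HarnessLib

/-!
# Crux `PatchingRelPerfect` (stmt-ResolutionOfSingularities-16161), chain W5.2 — F7(β) (β-AX) X2b, E-SIDE:
# END COMPONENTS of the multi-host CJS transport (the E-side input of T2c `IsFormatSncOn`)

[OURS · L1 W5.2 · F7(β) X2b E-side module B (res-L1-w52-plan-1 GO G11-11 / spec v4.1 §6 AMENDMENT A1; hand res-D-pv-054)]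
Fact-free; def-free; NOT statements of the manuscript under review (Hironaka 2017); AI-written, weaker than expert review.

At the END of the CJS sequence read on the carrier `E ≅ Z₁` (host traces `tr i` effective Cartier covering `e⁻¹X₁` and lying
over `X₁ ∪ B₁`; boundary traces `𝓑` with simple normal crossings and PREIRREDUCIBLE supports, drawn on `e⁻¹B₁` and covering it;
`X₁` closed and transversal to the strict normal crossings divisor `B₁`) there is ONE family `𝓔_E` of ideal sheaves on `E` with
simple normal crossings, WITHOUT DUPLICATES, whose non-unit members are the (prime) ideals of irreducible closed subsets, such
that EVERY boundary trace IS a member of `𝓔_E` and EVERY host trace is `monomialIdeal (𝓔_E.map fun S => (S, c S))` for an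
exponent function `c` — R5ᴴ N4 (`HSepCJS.exists_end_family`, `exists_factors_of_support_subset`, `exists_expFun_of_factors`)
instantiated with the total host divisor `Π tr i` and the boundary list, plus: an snc member with irreducible support inside a
strict normal crossings divisor `S` is the ideal of the closure of a maximal point of `S` (Krull: its generic point has
codimension one).

## References
* V. Cossart, U. Jannsen, S. Saito, LNM 2270 (2020), Thm. 1.4, Def. 4.1. [CossartJannsenSaito2020]
* J. Kollár, *Lectures on Resolution of Singularities* (2007), (3.111) Step 3. [Kollar2007]
* The Stacks Project, Tags 0BIA, 00KV. [StacksProject]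
-/

-- `Summit.<Summit>.<Sub>.Theorems` with `Sub = Summit` (single-conjunct summit, D-0017)
set_option linter.dupNamespace false

noncomputable section

open CategoryTheory CategoryTheory.Limits AlgebraicGeometry TopologicalSpace IsLocalRing
open Literature.AlgebraicGeometry.Resolution Scheme.IdealSheafData

namespace Summit.ResolutionOfSingularities.ResolutionOfSingularities.Theorems

universe u

namespace MultiHostCJS

open WeightTwoB

/-! ## §1 Two small tools -/

/-- Simple normal crossings are insensitive to a unit member (it passes through no point). [folklore] -/
theorem hasSNC_cons_top {X : Scheme.{u}} {𝓔 : List X.IdealSheafData} (h : HasSNC 𝓔) : HasSNC (⊤ :: 𝓔) := by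
  intro x
  obtain ⟨hreg, u, hu, ⟨ι, hι, hιD⟩, hC⟩ := h x
  have hmem : ∀ D : {D : X.IdealSheafData // D ∈ (⊤ :: 𝓔) ∧ x ∈ D.support}, D.1 ∈ 𝓔 ∧ x ∈ D.1.support := by
    rintro ⟨D, hD, hxD⟩
    rcases List.mem_cons.mp hD with rfl | hD
    · rw [Scheme.IdealSheafData.support_top] at hxD
      exact absurd hxD id
    · exact ⟨hD, hxD⟩
  refine ⟨hreg, u, hu, ⟨fun D => ι ⟨D.1, hmem D⟩, fun D₁ D₂ heq => ?_, fun D => hιD ⟨D.1, hmem D⟩⟩, hC⟩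
  have e := congrArg Subtype.val (hι heq)
  exact Subtype.ext e

/-- **An effective Cartier divisor with irreducible support has a generic point of codimension one** (Krull's Hauptidealsatz:
a point of codimension `≤ 1` on the support specialising to the generic point IS the generic point; codimension `0` is excluded
because the support is a proper closed subset). [cite: StacksProject, Tag 00KV] -/
theorem coheight_eq_one_of_isGenericPoint_support {E : Scheme.{u}} [IsIntegral E] [IsLocallyNoetherian E]
    {T : E.IdealSheafData} (hT : IsEffectiveCartier T) {ξ : E} (hξ : IsGenericPoint ξ (T.support : Set E)) :
    Order.coheight ξ = 1 := by
  obtain ⟨ξ', hξ'T, hsp, hle⟩ := hT.exists_specializes_coheight_le_one hξ.mem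
  have hsp' : ξ ⤳ ξ' := hξ.specializes hξ'T
  have heq : ξ' = ξ := (hsp.antisymm hsp').eq
  subst heq
  have h0 : Order.coheight ξ' ≠ 0 := by
    intro h0
    have hgen : ξ' = genericPoint E := eq_genericPoint_of_coheight_eq_zero h0
    exact not_mem_support_genericPoint (HSepCJS.ne_bot_of_isEffectiveCartier hT) (hgen ▸ hξ.mem)
  exact le_antisymm hle (Order.one_le_iff_ne_zero.mpr h0)

/-- **An snc member with irreducible support inside a strict normal crossings divisor `S` is the ideal of the closure of a maximal
point of `S`** (it is reduced, so it is the ideal of its support `cl{ξ}`, and `ξ` has codimension one). [cite: StacksProject, Tag 0BIA] -/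
theorem eq_vanishingIdeal_closure_of_isIrreducible {E : Scheme.{u}} [IsIntegral E] [IsLocallyNoetherian E]
    {𝓑 : List E.IdealSheafData} (h𝓑 : HasSNC 𝓑) {T : E.IdealSheafData} (hT : T ∈ 𝓑)
    (hirr : IsIrreducible (T.support : Set E)) {S : Set E} (hS : IsStrictNormalCrossingsDivisor E S)
    (hTS : (T.support : Set E) ⊆ S) :
    ∃ ξ ∈ maxPoints S, T = vanishingIdeal ⟨closure {ξ}, isClosed_closure⟩ := by
  obtain ⟨ξ, hξ⟩ : ∃ ξ : E, IsGenericPoint ξ (T.support : Set E) := QuasiSober.sober hirr T.support.isClosed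
  have hcoh := coheight_eq_one_of_isGenericPoint_support (h𝓑.isEffectiveCartier_of_mem hT) hξ
  refine ⟨ξ, DepthOne.mem_maxPoints_of_coheight_eq_one hS hcoh (hTS hξ.mem), ?_⟩
  have hcl : (⟨closure {ξ}, isClosed_closure⟩ : Closeds E) = T.support := Closeds.ext hξ.def
  rw [hcl, h𝓑.vanishingIdeal_support hT]

/-! ## §2 END COMPONENTS for the multi-host state -/

section End

variable {E Z₁ : Scheme.{u}} (e : E ≅ Z₁) {n : ℕ} {tr : Fin n → E.IdealSheafData} {𝓑 : List E.IdealSheafData}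
  {X₁ B₁ : Set Z₁}

/-- The total host divisor `Π tr i` contains `e⁻¹X₁` in its support. [folklore] -/
theorem preimage_subset_support_prod_ofFn (hlow : e.hom ⁻¹' X₁ ⊆ ⋃ i, ((tr i).support : Set E)) :
    e.hom ⁻¹' X₁ ⊆ (((List.ofFn tr).prod).support : Set E) := by
  intro x hx
  obtain ⟨i, hi⟩ := Set.mem_iUnion.mp (hlow hx)
  exact HSepCJS.mem_support_prod_iff.mpr ⟨tr i, List.mem_ofFn.mpr ⟨i, rfl⟩, hi⟩

/-- [OURS · L1 W5.2 · F7(β) X2b-E] **END COMPONENTS of the multi-host transport** (res-L1-w52-plan-1 GO G11-11 shape): see the module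
docstring.  The family is `(⊤ :: 𝓔₀).dedup` for the N4 family `𝓔₀` of the component ideals of `e⁻¹(X₁ ∪ B₁)` (the unit member absorbs
boundary traces whose support has emptied). [cite: CossartJannsenSaito2020, Thm. 1.4] [cite: Kollar2007, (3.111) Step 3]
[cite: StacksProject, Tag 0BIA] -/
theorem end_components [IsIntegral E] [IsNoetherian E] [IsNoetherian Z₁] (hE : Scheme.IsRegular E)
    (htr : ∀ i, IsEffectiveCartier (tr i)) (h𝓑 : HasSNC 𝓑) (h𝓑irr : ∀ T ∈ 𝓑, IsPreirreducible (T.support : Set E))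
    (hX₁c : IsClosed X₁) (htr₁ : IsTransversalWith Z₁ X₁ B₁) (hB₁ : IsStrictNormalCrossingsDivisor Z₁ B₁)
    (hlow : e.hom ⁻¹' X₁ ⊆ ⋃ i, ((tr i).support : Set E)) (hup : ∀ i, ((tr i).support : Set E) ⊆ e.hom ⁻¹' (X₁ ∪ B₁))
    (hbd : ∀ T ∈ 𝓑, (T.support : Set E) ⊆ e.hom ⁻¹' B₁) (hcov : ∀ x : E, e.hom x ∈ B₁ → ∃ T ∈ 𝓑, x ∈ T.support) :
    ∃ 𝓔 : List E.IdealSheafData, HasSNC 𝓔 ∧ 𝓔.Nodup ∧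
      (∀ S ∈ 𝓔, S ≠ ⊤ → ∃ ζ : E, S = vanishingIdeal ⟨closure {ζ}, isClosed_closure⟩) ∧
      (∀ S ∈ 𝓔, S ≠ ⊤ → IsIrreducible (S.support : Set E)) ∧
      (∀ S ∈ 𝓔, (S.support : Set E) ⊆ e.hom ⁻¹' (X₁ ∪ B₁)) ∧
      (∀ T ∈ 𝓑, T ∈ 𝓔) ∧
      (∀ i, ∃ c : E.IdealSheafData → ℕ, tr i = monomialIdeal (𝓔.map fun S => (S, c S))) := by
  classical
  -- N4 instantiated with the total host divisor and the boundary list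
  set D₁ : E.IdealSheafData := (List.ofFn tr).prod with hD₁def
  set ℰ₁ : List (E.IdealSheafData × ℕ) := 𝓑.map fun T => (T, 0) with hℰ₁def
  have hD₁ : IsEffectiveCartier D₁ :=
    HSepCJS.isEffectiveCartier_prod fun K hK => by
      obtain ⟨i, rfl⟩ := List.mem_ofFn.mp hK
      exact htr i
  have hbdry : boundaryOf ℰ₁ = 𝓑 := by simp [boundaryOf, hℰ₁def, Function.comp_def]
  have hℰ₁ : HasSNC (boundaryOf ℰ₁) := by rw [hbdry]; exact h𝓑
  have hlow' : e.hom ⁻¹' X₁ ⊆ (D₁.support : Set E) := preimage_subset_support_prod_ofFn e hlow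
  have hup' : (D₁.support : Set E) ⊆ e.hom ⁻¹' X₁ ∪ ⋃ p ∈ ℰ₁, (p.1.support : Set E) := by
    intro x hx
    obtain ⟨K, hK, hxK⟩ := HSepCJS.mem_support_prod_iff.mp hx
    obtain ⟨i, rfl⟩ := List.mem_ofFn.mp hK
    rcases hup i hxK with h | h
    · exact Or.inl h
    · obtain ⟨T, hT, hxT⟩ := hcov x h
      exact Or.inr (Set.mem_iUnion₂.mpr ⟨(T, 0), List.mem_map.mpr ⟨T, hT, rfl⟩, hxT⟩)
  have hbd' : ∀ p ∈ ℰ₁, (p.1.support : Set E) ⊆ e.hom ⁻¹' B₁ := by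
    intro p hp
    obtain ⟨T, hT, rfl⟩ := List.mem_map.mp hp
    exact hbd T hT
  have hcov' : ∀ x : E, e.hom x ∈ B₁ → ∃ p ∈ ℰ₁, x ∈ p.1.support := by
    intro x hx
    obtain ⟨T, hT, hxT⟩ := hcov x hx
    exact ⟨(T, 0), List.mem_map.mpr ⟨T, hT, rfl⟩, hxT⟩
  obtain ⟨𝓔₀, h𝓔₀, hprime, hirr, hne, hU, hmax⟩ :=
    HSepCJS.exists_end_family e hE hD₁ hℰ₁ hX₁c htr₁ hB₁ hlow' hup' hbd' hcov'
  have hS : IsStrictNormalCrossingsDivisor E (e.hom ⁻¹' (X₁ ∪ B₁)) :=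
    (HSepCJS.isStrictNormalCrossingsDivisor_union_end e hD₁ hℰ₁ hX₁c htr₁ hB₁ hlow' hup' hbd' hcov').preimage_of_etale e.hom
  -- the family
  refine ⟨(⊤ :: 𝓔₀).dedup, HSepCJS.hasSNC_dedup (hasSNC_cons_top h𝓔₀), List.nodup_dedup _, fun S hS' hSt => ?_,
    fun S hS' hSt => ?_, fun S hS' => ?_, fun T hT => ?_, fun i => ?_⟩
  · rcases List.mem_cons.mp (List.mem_dedup.mp hS') with h | h
    · exact absurd h hSt
    · exact hprime S h
  · rcases List.mem_cons.mp (List.mem_dedup.mp hS') with h | h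
    · exact absurd h hSt
    · exact hirr S h
  · rcases List.mem_cons.mp (List.mem_dedup.mp hS') with h | h
    · subst h
      rw [Scheme.IdealSheafData.support_top]
      exact fun x hx => absurd hx id
    · rw [← hU]
      exact Set.subset_iUnion₂ (s := fun (T : E.IdealSheafData) (_ : T ∈ 𝓔₀) => (T.support : Set E)) S h
  · -- a boundary trace: empty support ⇒ the unit member; irreducible support ⇒ a component ideal
    refine List.mem_dedup.mpr ?_
    rcases (T.support : Set E).eq_empty_or_nonempty with h0 | hne'
    · have hTtop : T = ⊤ := by
        rw [← Scheme.IdealSheafData.support_eq_bot_iff]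
        exact Closeds.ext h0
      rw [hTtop]
      exact List.mem_cons_self
    · have hTirr : IsIrreducible (T.support : Set E) := ⟨hne', h𝓑irr T hT⟩
      obtain ⟨ξ, hξ, hTξ⟩ := eq_vanishingIdeal_closure_of_isIrreducible h𝓑 hT hTirr hS
        ((hbd T hT).trans (Set.preimage_mono Set.subset_union_right))
      rw [hTξ]
      exact List.mem_cons_of_mem _ (hmax ξ hξ)
  · -- a host trace: factors among the component ideals, then the exponent-function form over the dedup'd family
    obtain ⟨q, hq, hq'⟩ := HSepCJS.exists_factors_of_support_subset E hE hS hmax (tr i) (htr i) (hup i)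
    obtain ⟨c, hc⟩ := HSepCJS.exists_expFun_of_factors (List.nodup_dedup (⊤ :: 𝓔₀)) q fun f hf =>
      List.mem_dedup.mpr (List.mem_cons_of_mem _ (hq f hf))
    exact ⟨c, hq'.trans hc⟩

end End

end MultiHostCJS

end Summit.ResolutionOfSingularities.ResolutionOfSingularities.Theorems

end
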